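import Summits.ResolutionOfSingularities.ResolutionOfSingularities.Theorems.PurelyInseparableDim4Target
import Summits.ResolutionOfSingularities.ResolutionOfSingularities.Theorems.PurelyInseparableDim4Rules
import HarnessLib
import HarnessLib.Audit.Tags

/-!
# Purely inseparable dim-4 census — SCOPE add-on (frame v4, cell res-dim4-pi WORD #20)

Defs-only add-on to `PurelyInseparableDim4Target` / `…Rules`.  The coordinate-centre frame
(`CentreRule K := State K → Finset (Fin 4)`) is BLIND wherever the `q`-fold locus of `z^q + F`
acquires a regular NON-COORDINATE component through the point (TRAP-1 of the cell: a one-state trap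
at `p = 2`, already present for `(n,e) = (3,1)`), so termination statements are re-scoped to the two
regimes in which a coordinate rule is NOT a restriction of Hironaka's player A:

* the **SPINE** (`t = 0`: chart origins only) — there the walk is Hironaka's original polyhedra game
  plus cleaning deletions [cite: Spivakovsky1983] [cite: Hauser2003, §1 (the polyhedra game)];
* the **ISOLATED** regime — states whose `q`-fold locus `V(J_q(F))`
  is the origin alone (`J_q(F) = ⟨D^α F : 0 < |α| < q⟩`, without `F`: the value of `F` is absorbed by
  `z`); there the point is the only Hironaka-permissible centre for everybody;

plus the in-scope variant of `TerminatesSomeRule` (every component of the `q`-fold locus through the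
point is a coordinate subspace).  Nothing here is a theorem about resolution in dimension ≥ 4.
-/

set_option linter.dupNamespace false -- mandated namespace of this single-conjunct summit

namespace Summit.ResolutionOfSingularities.ResolutionOfSingularities.Theorems.PIDim4

open MvPolynomial Finset
open Literature.AlgebraicGeometry.Resolution

/-! ## 1. The `q`-fold locus ideal -/

/-- **Hasse derivative** `D^{(α)}` on polynomials: `x^d ↦ (∏ᵢ C(dᵢ, αᵢ)) x^{d−α}` (zero when `α ≰ d`).
[cite: Giraud1975, §1 (Hasse–Schmidt derivations)] [folklore] -/
noncomputable def hasseDeriv {K : Type} [Field K] (α : Fin 4 →₀ ℕ) (F : MvPolynomial (Fin 4) K) :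
    MvPolynomial (Fin 4) K :=
  ∑ d ∈ F.support, monomial (d - α) ((∏ i, (Nat.choose (d i) (α i) : K)) * coeff d F)

/-- **The ideal of the `q`-fold locus** of `z^q + F`: `J_q⁺(F) = ⟨D^{(α)} F : 0 < |α| < q⟩` — WITHOUT
`F` itself: over a perfect field the points of multiplicity `q` of `z^q + F` are the `(b, c)` with
`c^q = −F(b)` and `D^{(α)}F(b) = 0` for `0 < |α| < q` (the value `F(b)` is absorbed by `z ↦ z + c`, exactly
as the walk's cleaning deletes the constant term), so the `q`-fold locus projects onto `V(J_q⁺(F))`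
(cell note T-ISO-1). [cite: Giraud1975, §1] [cite: CossartPiltant2019, Prop. 2.55 (Hasse derivatives)] -/
noncomputable def singLocusIdeal {K : Type} [Field K] (q : ℕ) (F : MvPolynomial (Fin 4) K) :
    Ideal (MvPolynomial (Fin 4) K) :=
  Ideal.span {G | ∃ α : Fin 4 →₀ ℕ, 0 < α.degree ∧ α.degree < q ∧ G = hasseDeriv α F}

/-- The maximal ideal of the origin, `𝔪₀ = ker (eval 0) = (x₁, …, x₄)`. [folklore] -/
noncomputable def originIdeal (K : Type) [Field K] : Ideal (MvPolynomial (Fin 4) K) :=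
  RingHom.ker (MvPolynomial.eval (0 : Fin 4 → K))

/-- **Coordinate ideal** `(xᵢ : i ∈ S)`. [folklore] -/
def IsCoordinateIdeal {K : Type} [Field K] (P : Ideal (MvPolynomial (Fin 4) K)) : Prop :=
  ∃ S : Finset (Fin 4), P = Ideal.span ((fun i => (X i : MvPolynomial (Fin 4) K)) '' (S : Set (Fin 4)))

/-- **ISOLATED `q`-fold point**: the origin is `q`-fold (`J_q⁺(F) ≤ 𝔪₀`) and every minimal prime of
`J_q⁺(F)` through the origin is `𝔪₀` itself (no equimultiple curve through the point). [folklore] -/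
def IsIsolated {K : Type} [Field K] (q : ℕ) (F : MvPolynomial (Fin 4) K) : Prop :=
  singLocusIdeal q F ≤ originIdeal K ∧
    ∀ P ∈ (singLocusIdeal q F).minimalPrimes, P ≤ originIdeal K → P = originIdeal K

/-- **In coordinate scope**: every component of the `q`-fold locus through the origin is a coordinate
subspace `V(x_S)` of the current chart (then the Hironaka-permissible REGULAR centres through the
point that are components of the locus are all available to a coordinate rule). [folklore] -/
def InCoordinateScope {K : Type} [Field K] (q : ℕ) (F : MvPolynomial (Fin 4) K) : Prop :=
  ∀ P ∈ (singLocusIdeal q F).minimalPrimes, P ≤ originIdeal K → IsCoordinateIdeal P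

/-! ## 2. Frame v4 statements -/

/-- **F4-I `NoIsolatedTrap p q`**: there is no infinite branch of point blow-ups (`Step0`) all of whose
states are ISOLATED `q`-fold points.  In this regime the point is the only permissible centre for
Hironaka's player A as well, so the coordinate game is not a restriction. [folklore] -/
def NoIsolatedTrap (p q : ℕ) : Prop :=
  ∀ (K : Type) [Field K] [CharP K p] [DecidableEq K],
    ¬ ∃ c : ℕ → State K, ∀ k, IsIsolated q (c k).F ∧ Step0 q (c k) (c (k + 1))

/-- **F4-C `TerminatesInScope p q`**: some permissible coordinate rule has no infinite branch staying
inside the coordinate scope. (The refuted `TerminatesSomeRule 2 2` fails exactly by leaving it.) [folklore] -/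
def TerminatesInScope (p q : ℕ) : Prop :=
  ∀ (K : Type) [Field K] [CharP K p] [DecidableEq K],
    ∃ R : CentreRule K, IsPermissibleRule q R ∧
      ¬ ∃ c : ℕ → State K, ∀ k, InCoordinateScope q (c k).F ∧ StepRule q R (c k) (c (k + 1))

/-- **Spine edge**: the blow-up edge read at the chart ORIGIN (`b = 0`, the engines' `t = 0`).
[cite: HauserPerlega2019PRIMS, §2 (the blowup in the x₁-chart)] -/
def SpineEdge {K : Type} [Field K] [DecidableEq K] (q : ℕ) (S : Finset (Fin 4))
    (s s' : State K) : Prop :=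
  ∃ j : Fin 4, j ∈ S ∧ CentreBlowup.IsEquimultiplePoint q S j (0 : Fin 4 → K) s ∧
    (CentreBlowup.step q S j (0 : Fin 4 → K) s).F ≠ 0 ∧ s' = CentreBlowup.step q S j (0 : Fin 4 → K) s

/-- No infinite SPINE branch under the rule `R`. [folklore] -/
def SpineTerminatesUnder {K : Type} [Field K] [DecidableEq K] (q : ℕ) (R : CentreRule K) : Prop :=
  ¬ ∃ c : ℕ → State K, ∀ k, IsPermissibleCentre q (R (c k)) (c k).F ∧ SpineEdge q (R (c k)) (c k) (c (k + 1))

/-- **F4-S `SpineTerminatesSomeRule p q`**: some permissible coordinate rule wins the spine game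
(Hironaka's original polyhedra game with cleaning deletions).
[cite: Spivakovsky1983, Thm (a winning strategy for Hironaka's polyhedra game)] -/
def SpineTerminatesSomeRule (p q : ℕ) : Prop :=
  ∀ (K : Type) [Field K] [CharP K p] [DecidableEq K],
    ∃ R : CentreRule K, IsPermissibleRule q R ∧ SpineTerminatesUnder q R

/-- QUESTION F4-I for the class of record (`e = 1`). Not a theorem of the literature. -/
@[conjecture] def NoIsolatedTrapQuestion : Prop := ∀ p : ℕ, p.Prime → NoIsolatedTrap p p

/-- QUESTION F4-C for the class of record (`e = 1`). Not a theorem of the literature. -/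
@[conjecture] def TerminatesInScopeQuestion : Prop := ∀ p : ℕ, p.Prime → TerminatesInScope p p

/-- QUESTION F4-S for the class of record (`e = 1`); expected to follow from a deletion-robust
winning strategy of the polyhedra game. Not a theorem of the literature as stated. -/
@[conjecture] def SpineTerminatesSomeRuleQuestion : Prop := ∀ p : ℕ, p.Prime → SpineTerminatesSomeRule p p

/-! ## 3. The cheap implications -/

/-- A spine edge is an edge. [folklore] -/
theorem edge_of_spineEdge {K : Type} [Field K] [DecidableEq K] (q : ℕ) (S : Finset (Fin 4))
    (s s' : State K) (h : SpineEdge q S s s') : Edge q S s s' := by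
  obtain ⟨j, hj, heq, hne, hs⟩ := h
  exact ⟨j, 0, hj, rfl, heq, hne, hs⟩

/-- `TerminatesSomeRule` implies the spine statement. [folklore] -/
theorem spineTerminatesSomeRule_of_terminatesSomeRule (p q : ℕ) (h : TerminatesSomeRule p q) :
    SpineTerminatesSomeRule p q := by
  intro K _ _ _
  obtain ⟨R, hR, hT⟩ := h K
  refine ⟨R, hR, ?_⟩
  rintro ⟨c, hc⟩
  exact hT ⟨c, fun k => ⟨(hc k).1, edge_of_spineEdge q _ _ _ (hc k).2⟩⟩

/-- `TerminatesSomeRule` implies the in-scope statement. [folklore] -/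
theorem terminatesInScope_of_terminatesSomeRule (p q : ℕ) (h : TerminatesSomeRule p q) :
    TerminatesInScope p q := by
  intro K _ _ _
  obtain ⟨R, hR, hT⟩ := h K
  refine ⟨R, hR, ?_⟩
  rintro ⟨c, hc⟩
  exact hT ⟨c, fun k => (hc k).2⟩

end Summit.ResolutionOfSingularities.ResolutionOfSingularities.Theorems.PIDim4
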